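import Literature.NumberTheory.EllipticCurves.XCubeAddPQSqThreeDescent
import Literature.NumberTheory.NumberFields.EisensteinFieldSelmerInert
import HarnessLib

/-!
# The Mordell curves `A_t : y² = x³ + t²`, `t` odd with every prime factor `≡ 2 (mod 3)`: the `√−3`-Selmer group over
# `ℚ(ζ₃)` lies in the box `⟨[q] : q ∣ 2t⟩`; `rank A_t(ℚ) ≤ ω(t)` unconditionally; sharpness criterion for `Ш[3] = 0`
# and `rank = ω(t)`

Topic `NumberTheory/EllipticCurves`. Uniform version of `XCubeAddPQSqThreeDescent.lean` (Jeong's family, `t = pq`) and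
`XCubeSub81675ThreeDescentSelmer.lean` (`t = 55`): for ANY natural number `t ≠ 0`, odd, all of whose prime factors are
`≡ 2 (mod 3)` (so that every prime `q ∣ 2t` is inert in `K3 = ℚ(ζ₃)`), put `θ = √−3` and consider over `K3`

  `A : Y² = X³ + (3tθ)² = X³ − 27t²` (`= E_D`, `D = −3c²`, `c = 3t`), `A' = E_{81c²} : Y² = X³ + (27t)²`,
  the `μ₃`-torsor classes `[C_a] ∈ H¹(K3, A)` (kernel point `T = (0, 3tθ)`), the descent map
  `δ = phiDescent (3t) : A'(·) → ·`, `(X, Y) ↦ Y + 27t`, and the complex multiplication `f = [√−3] ∈ End_{K3}(A)`.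

Over `ℚ`: `A' ≅ A_t : y² = x³ + t²` (`u = 1/3`) and `A` is its `−3`-twist `E : y² = x³ − 27t²`, `3`-isogenous to it.

* §1 `f ∘ f = [−3]`, `ker f = {O, ±T}`, `f` onto.
* §2 **The Selmer box** (`MordellT.exists_cubeClass_eq_of_sha`): if `[C_a] ∈ Ш(A/K3)` then `[a] = [∏_{q ∣ 2t} q^{e q}]`,
  `e q < 3` — local necessity at the completions: `3 ∣ ord_v(a)` for `v ∤ 6t` and at `λ` (`ord_λ(54t) = 6`),
  `χ₂(a) = 0` (`27t` is a `2`-unit); then `K(S,3)` for `S = {λ} ∪ {q ∣ 2t}` (`EisensteinFieldSelmerInert`).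
* §3 **`rank A_t(ℚ) ≤ ω(t)` for ALL such `t`** (`MordellT.mordellWeilRank_le_card_primeFactors`): the descent classes of
  `A'(K3)` lie in the box, the box has `3^{ω(2t)} = 3^{ω(t)+1}` elements, and `#δ(A'(K3)) = 3^{rank A'(ℚ)+1}`
  (`natCard_range_cubicDescentClass_eq`). (`t = 1`: rank `0` for `y² = x³ + 1`; `t` prime: rank `≤ 1`; `t = pq`: Jeong.)
* §4 **Sharpness criterion** (`MordellT.door_at_three_of_generators`): if every `[q]`, `q ∣ 2t` prime, is the descent class
  of a point of `A'(K3)` (rational points usually provide them), then `Ш(A/K3) ∩ ker f_* = 0`, `Ш(A/K3)[3] = 0`,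
  `Ш(E/ℚ)[3^∞] = 0` and `corank_{ℤ₃} Ш(E/ℚ) = 0` for `E : y² = x³ − 27t²`, and `rank A_t(ℚ) = rank E(ℚ) = ω(t)` exactly —
  the door at `3` at rank `ω(t)`.

## References

* [Jeong2019RankExactlyTwoII] K. Jeong, Proc. Japan Acad. Ser. A 95 (2019) 53–57, §3, Lemma 3.3, Prop. 3.5 (`t = pq`).
* [CohenPazuki2009] H. Cohen, F. Pazuki, Acta Arith. 140 (2009) 369–404, Thm. 2.1, §5.
* [SilvermanAEC2009] J. H. Silverman, *AEC* 2nd ed., Thm. X.4.2, Remark X.4.7, Prop. X.4.9, Exercise 10.9.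
* [Greenberg1999LNM] R. Greenberg, LNM 1716 (1999), §1.
-/

noncomputable section

open scoped Classical WithZero

open WeierstrassCurve IsDedekindDomain IsDedekindDomain.HeightOneSpectrum NumberField
open WithZero (log exp)
open Literature.NumberTheory.NumberFields Literature.NumberTheory.NumberFields.K3
open Literature.NumberTheory.GaloisRepresentations

namespace Literature.NumberTheory.EllipticCurves

namespace MordellT

variable {t : ℕ} [htz : NeZero t]

/-! ## §0 The parameters: `c = 3t`, `B_A = 3tθ` -/

/-- `t ≠ 0` in `K3`. [folklore] -/
private theorem t_ne_zero : ((t : ℕ) : K3) ≠ 0 := by exact_mod_cast htz.ne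

/-- `c = 3t ≠ 0` in `K3` (the parameter of `A = E_{−3c²}`). [cite: Jeong2019RankExactlyTwoII, §3] -/
theorem hc : ((3 * t : ℕ) : K3) ≠ 0 := by exact_mod_cast (Nat.mul_ne_zero (by norm_num) htz.ne)

/-- `B_A = 3tθ ≠ 0`. [cite: Jeong2019RankExactlyTwoII, §3] -/
theorem hBA : ((3 * t : ℕ) : K3) * theta ≠ 0 :=
  mul_ne_zero hc fun h => by
    have := theta_sq; rw [h] at this; norm_num at this

omit htz in
/-- `A = E_D`, `D = B_A² = −3c²`. [cite: Jeong2019RankExactlyTwoII, §3] -/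
theorem hD : (((3 * t : ℕ) : K3) * theta) ^ 2 = -3 * ((3 * t : ℕ) : K3) ^ 2 := by
  rw [mul_pow, theta_sq]; ring

/-! ## §1 `f = [√−3]` on `A`: `f ∘ f = [−3]`, kernel, surjectivity -/

/-- **`f ∘ f = [−3]`** on `A(K̄)` (`σ = ` complex conjugation: `σθ = −θ`, `σB_A = −B_A`). [cite: SilvermanAEC2009, Cor. III.6.3] -/
theorem f_comp_self (P : (mordellCurve ((((3 * t : ℕ) : K3) * theta) ^ 2)).geomPoints) :
    (SqrtThree.sqrtThree hBA theta_sq) ((SqrtThree.sqrtThree hBA theta_sq) P) = -((3 : ℤ) • P) := by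
  refine SqrtThree.sqrtThree_comp_self' conjBar conjBar_theta ?_ hBA theta_sq P
  rw [map_mul, map_mul, conjBar_theta, mul_neg]
  congr 1
  have : (((3 * t : ℕ) : ℚ) : K3) = ((3 * t : ℕ) : K3) := by push_cast; ring
  rw [← this, conjBar_ratCast]

/-- **`ker f ⊆ {O, ±T}`**, `T = (0, 3tθ)`. [cite: CohenPazuki2009, Thm. 2.1] -/
theorem f_ker (P : (mordellCurve ((((3 * t : ℕ) : K3) * theta) ^ 2)).geomPoints)
    (h0 : (SqrtThree.sqrtThree hBA theta_sq) P = 0) :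
    P = 0 ∨ P = MordellDescent.torsT hc hD ∨ P = -MordellDescent.torsT hc hD := by
  rcases P with _ | ⟨x, y, hxy⟩
  · exact Or.inl rfl
  · have hx : x = 0 := SqrtThree.sqrtThree_eq_zero_imp hBA theta_sq hxy h0
    exact Or.inr ((MordellDescent.isVeluThreePair_mordell hc hD).some_eq_T_or hxy hx)

/-- `f` is onto `A(K̄)`. [cite: SilvermanAEC2009, Thm. II.2.3] -/
theorem f_surjective : Function.Surjective (SqrtThree.sqrtThree (hBA (t := t)) theta_sq).toAddMonoidHom := by
  haveI := isElliptic_mordellCurve (pow_ne_zero 2 (hBA (t := t)))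
  exact Isogeny.surjective _

/-! ## §2 The Selmer box: local conditions necessary for `[C_a] ∈ Ш(A/K3)` -/

/-- The valuation of `K3_v` restricts to `v` on `K3`. [folklore] -/
private theorem v_algebraMap (v : HeightOneSpectrum (𝓞 K3)) (x : K3) :
    Valued.v (algebraMap K3 (v.adicCompletion K3) x) = v.valuation K3 x :=
  valuedAdicCompletion_eq_valuation' v x

omit htz in
/-- `54t = 9·(6t) ∉ 𝔭_v` for `v ∤ 6t`. [folklore] -/
private theorem natCast_54t_not_mem {v : HeightOneSpectrum (𝓞 K3)} (hv : ((3 * (2 * t) : ℕ) : 𝓞 K3) ∉ v.asIdeal) :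
    ((54 * t : ℕ) : 𝓞 K3) ∉ v.asIdeal := by
  intro h
  have h' : (3 : 𝓞 K3) * (3 * ((3 * (2 * t) : ℕ) : 𝓞 K3)) ∈ v.asIdeal := by
    have e : (3 : 𝓞 K3) * (3 * ((3 * (2 * t) : ℕ) : 𝓞 K3)) = ((54 * t : ℕ) : 𝓞 K3) := by push_cast; ring
    rw [e]; exact h
  have h3 : (3 : 𝓞 K3) ∈ v.asIdeal → False := fun h3 =>
    hv (by rw [show ((3 * (2 * t) : ℕ) : 𝓞 K3) = 3 * ((2 * t : ℕ) : 𝓞 K3) by push_cast; ring]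
           exact v.asIdeal.mul_mem_right _ h3)
  rcases v.isPrime.mem_or_mem h' with h3' | h''
  · exact h3 h3'
  · rcases v.isPrime.mem_or_mem h'' with h3' | h6
    · exact h3 h3'
    · exact hv h6

/-- `χ₂` is a level-one residue character for `val₂` on `K3`. [cite: IrelandRosen1990, Ch. 9 §3] -/
private theorem isResidueChar_chi2' : MordellDescent.IsResidueChar (val prime_natCast_two) chi2 :=
  ⟨fun hx hy ↦ chi_mul _ cubicChar_mul_two hx hy, fun h ↦ chi_eq_of_val_sub_lt _ h,
    chi_neg_one _ cubicChar_ratCast_two⟩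

/-- In a `K3`-algebra `L`: `9 · c = 27t` and `2 · 9 · c = 54t` through `algebraMap`, and `9c ≠ 0` (in characteristic `0`).
[folklore] -/
private theorem algebraMap_facts (L : Type) [Field L] [Algebra K3 L] :
    (9 : L) * algebraMap K3 L ((3 * t : ℕ) : K3) = algebraMap K3 L ((27 * t : ℕ) : K3) ∧
      (2 : L) * (9 * algebraMap K3 L ((3 * t : ℕ) : K3)) = algebraMap K3 L ((54 * t : ℕ) : K3) ∧
      (9 : L) * algebraMap K3 L ((3 * t : ℕ) : K3) ≠ 0 := by
  haveI : CharZero L := charZero_of_injective_algebraMap (algebraMap K3 L).injective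
  refine ⟨?_, ?_, ?_⟩
  · rw [map_natCast, map_natCast]; push_cast; ring
  · rw [map_natCast, map_natCast]; push_cast; ring
  · rw [map_natCast]
    exact_mod_cast (Nat.mul_ne_zero (by norm_num) (Nat.mul_ne_zero (by norm_num) htz.ne))

section Local

variable (hodd : ¬ 2 ∣ t) (hinert : ∀ q ∈ t.primeFactors, q % 3 = 2)
variable {a : K3} (ha : a ≠ 0)
  (hsha : MordellDescent.torsorClass hc hD ha ∈ (mordellCurve ((((3 * t : ℕ) : K3) * theta) ^ 2)).sha)

include hinert in
/-- `3 ∤ t` (all prime factors of `t` are `≡ 2 (mod 3)`). [cite: IrelandRosen1990, Prop. 9.1.4] -/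
theorem not_three_dvd_t : ¬ 3 ∣ t := by
  intro h3
  have hmem : 3 ∈ t.primeFactors := Nat.mem_primeFactors.mpr ⟨Nat.prime_three, h3, htz.ne⟩
  have := hinert 3 hmem
  omega

include hinert in
/-- **Every prime `q ∣ 2t` is inert** (`q = 2` or `q ≡ 2 (mod 3)`): the hypothesis of `EisensteinFieldSelmerInert` for
`N = 2t`. [cite: IrelandRosen1990, Prop. 9.1.4] -/
theorem inert_two_mul : ∀ q ∈ (2 * t).primeFactors, q = 2 ∨ q % 3 = 2 := by
  intro q hq
  rw [Nat.primeFactors_mul two_ne_zero htz.ne, Finset.mem_union, Nat.Prime.primeFactors Nat.prime_two,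
    Finset.mem_singleton] at hq
  rcases hq with rfl | hq
  · exact Or.inl rfl
  · exact Or.inr (hinert q hq)

include hodd in
/-- `(2t).primeFactors = {2} ∪ t.primeFactors` (disjointly, `t` odd), so `ω(2t) = ω(t) + 1`: the size `3^{ω(t)+1}` of the
Selmer box `⟨[2], [p] : p ∣ t⟩`. [cite: Jeong2019RankExactlyTwoII, Lemma 3.3] -/
theorem card_primeFactors_two_mul : (2 * t).primeFactors.card = t.primeFactors.card + 1 := by
  rw [Nat.primeFactors_mul two_ne_zero htz.ne, Nat.Prime.primeFactors Nat.prime_two,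
    Finset.card_union_of_disjoint (Finset.disjoint_singleton_left.mpr fun h => hodd (Nat.dvd_of_mem_primeFactors h)),
    Finset.card_singleton, add_comm]

include hsha in
/-- **At the places `v ∤ 6t`: `3 ∣ ord_v(a)`** (`ord_v(54t) = 0`). [cite: CohenPazuki2009, Thm. 2.1] -/
theorem three_dvd_log_valuation_of_sha (v : HeightOneSpectrum (𝓞 K3)) (hv : ((3 * (2 * t) : ℕ) : 𝓞 K3) ∉ v.asIdeal) :
    (3 : ℤ) ∣ log (v.valuation K3 a) := by
  set L := v.adicCompletion K3 with hL
  haveI : CharZero L := charZero_of_injective_algebraMap (algebraMap K3 L).injective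
  obtain ⟨P, w, hw, hδ⟩ :=
    MordellDescent.exists_phiDescent_eq_adicCompletion_of_torsorClass_mem_sha hc hD ha hsha v
  obtain ⟨-, h54, hcL⟩ := algebraMap_facts (t := t) L
  have haL : algebraMap K3 L a ≠ 0 := (map_ne_zero (algebraMap K3 L)).mpr ha
  have hW : mordellCurve (81 * algebraMap K3 L ((3 * t : ℕ) : K3) ^ 2) =
      mordellCurve ((9 * algebraMap K3 L ((3 * t : ℕ) : K3)) ^ 2) := by
    congr 1; ring
  have hv54 : (3 : ℤ) ∣ log (Valued.v ((2 : L) * (9 * algebraMap K3 L ((3 * t : ℕ) : K3)))) := by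
    rw [h54, v_algebraMap, ← coe_natCast_ringOfIntegers,
      valuation_coe_eq_one v (natCast_54t_not_mem hv), WithZero.log_one]
    exact dvd_zero 3
  have key := (Valued.v (R := L)).three_dvd_log_cubicDescent_of_dvd hW hcL two_ne_zero hv54 P
  rw [← MordellDescent.phiDescent_eq_cubicDescent, hδ, Valuation.log_map_mul _ haL (pow_ne_zero 3 hw),
    Valuation.log_map_pow, v_algebraMap] at key
  have : (3 : ℤ) ∣ log (v.valuation K3 a) + 3 * log (Valued.v w) := key
  omega

include hinert hsha in
/-- At `λ`: `3 ∣ ord_λ(a)` (`ord_λ(54t) = ord_λ(27) = 6`, `3 ∤ 2t`). [cite: CohenPazuki2009, Thm. 2.1 and §5] -/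
private theorem three_dvd_log_vL_of_sha_t : (3 : ℤ) ∣ log (vL a) := by
  set v : HeightOneSpectrum (𝓞 K3) := placeOfPrime prime_lamInt with hvdef
  set L := v.adicCompletion K3 with hL
  haveI : CharZero L := charZero_of_injective_algebraMap (algebraMap K3 L).injective
  obtain ⟨P, w, hw, hδ⟩ :=
    MordellDescent.exists_phiDescent_eq_adicCompletion_of_torsorClass_mem_sha hc hD ha hsha v
  obtain ⟨-, h54, hcL⟩ := algebraMap_facts (t := t) L
  have haL : algebraMap K3 L a ≠ 0 := (map_ne_zero (algebraMap K3 L)).mpr ha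
  have hW : mordellCurve (81 * algebraMap K3 L ((3 * t : ℕ) : K3) ^ 2) =
      mordellCurve ((9 * algebraMap K3 L ((3 * t : ℕ) : K3)) ^ 2) := by
    congr 1; ring
  have h2t : ¬ 3 ∣ 2 * t := by
    intro h
    rcases (Nat.Prime.dvd_mul Nat.prime_three).mp h with h | h
    · omega
    · exact not_three_dvd_t hinert h
  have hv54 : (3 : ℤ) ∣ log (Valued.v ((2 : L) * (9 * algebraMap K3 L ((3 * t : ℕ) : K3)))) := by
    rw [h54, v_algebraMap, show ((54 * t : ℕ) : K3) = 3 ^ 3 * ((2 * t : ℕ) : K3) by push_cast; ring,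
      Valuation.log_map_mul _ (by norm_num) (by exact_mod_cast (Nat.mul_ne_zero two_ne_zero htz.ne)),
      Valuation.log_map_pow]
    change (3 : ℤ) ∣ 3 * log (vL 3) + log (vL ((2 * t : ℕ) : K3))
    rw [vL_three, WithZero.log_exp, log_val_lam_natCast h2t]
    norm_num
  have key := (Valued.v (R := L)).three_dvd_log_cubicDescent_of_dvd hW hcL two_ne_zero hv54 P
  rw [← MordellDescent.phiDescent_eq_cubicDescent, hδ, Valuation.log_map_mul _ haL (pow_ne_zero 3 hw),
    Valuation.log_map_pow, v_algebraMap] at key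
  have : (3 : ℤ) ∣ log (vL a) + 3 * log (Valued.v w) := key
  omega

include hodd hsha in
/-- At `2`: `χ₂(a) = 0` (`27t` is a `2`-unit since `t` is odd; `ord_2(54t) = 1`; the character extended to `K3_2` by
density kills the local descent value). [cite: CohenPazuki2009, §5] [cite: Jeong2019RankExactlyTwoII, Lemma 3.4 (iii)] -/
private theorem chi2_eq_zero_of_sha_t : chi2 a = 0 := by
  set v : HeightOneSpectrum (𝓞 K3) := placeOfPrime prime_natCast_two with hvdef
  set L := v.adicCompletion K3 with hL
  haveI : CharZero L := charZero_of_injective_algebraMap (algebraMap K3 L).injective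
  obtain ⟨P, w, hw, hδ⟩ :=
    MordellDescent.exists_phiDescent_eq_adicCompletion_of_torsorClass_mem_sha hc hD ha hsha v
  obtain ⟨χL, hχL, hχLK⟩ := isResidueChar_chi2'.exists_isResidueChar_extension (L := L)
    (fun y => v_algebraMap v y) (denseRange_algebraMap K3 v)
  obtain ⟨h27, h54, hcL⟩ := algebraMap_facts (t := t) L
  have haL : algebraMap K3 L a ≠ 0 := (map_ne_zero (algebraMap K3 L)).mpr ha
  have hW : mordellCurve (81 * algebraMap K3 L ((3 * t : ℕ) : K3) ^ 2) =
      mordellCurve ((9 * algebraMap K3 L ((3 * t : ℕ) : K3)) ^ 2) := by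
    congr 1; ring
  have R := cubicChar_ratCast_two
  have hχB : χL ((9 : L) * algebraMap K3 L ((3 * t : ℕ) : K3)) = 0 := by
    rw [h27, hχLK]; exact chi_natCast _ R _
  have hχ2B : χL ((2 : L) * (9 * algebraMap K3 L ((3 * t : ℕ) : K3))) = 0 := by
    rw [h54, hχLK]; exact chi_natCast _ R _
  have h27odd : ¬ 2 ∣ 27 * t := by
    intro h
    rcases (Nat.Prime.dvd_mul Nat.prime_two).mp h with h | h
    · omega
    · exact hodd h
  have hvB : Valued.v ((9 : L) * algebraMap K3 L ((3 * t : ℕ) : K3)) = 1 := by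
    rw [h27, v_algebraMap]; exact val_natCast_of_not_dvd prime_natCast_two h27odd
  have hv2B : Valued.v ((2 : L) * (9 * algebraMap K3 L ((3 * t : ℕ) : K3))) = exp (-1) := by
    rw [h54, v_algebraMap, show ((54 * t : ℕ) : K3) = ((2 : ℕ) : K3) * ((27 * t : ℕ) : K3) by push_cast; ring,
      Valuation.map_mul]
    change val prime_natCast_two _ * val prime_natCast_two _ = _
    rw [val_natCast_self, val_natCast_of_not_dvd prime_natCast_two h27odd, mul_one]
  have hwin : ∀ n : ℤ, log (Valued.v ((2 : L) * (9 * algebraMap K3 L ((3 * t : ℕ) : K3)))) ≤ n →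
      n ≤ log (Valued.v ((9 : L) * algebraMap K3 L ((3 * t : ℕ) : K3))) → (3 : ℤ) ∣ n →
      n = log (Valued.v ((9 : L) * algebraMap K3 L ((3 * t : ℕ) : K3))) ∧
        Valued.v ((2 : L) * (9 * algebraMap K3 L ((3 * t : ℕ) : K3))) <
          Valued.v ((9 : L) * algebraMap K3 L ((3 * t : ℕ) : K3)) := by
    intro n h1 h2 h3
    rw [hv2B, WithZero.log_exp] at h1
    rw [hvB, WithZero.log_one] at h2 ⊢
    refine ⟨by omega, ?_⟩
    rw [hv2B, ← WithZero.exp_zero]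
    exact WithZero.exp_lt_exp.mpr (by norm_num)
  have key := hχL.apply_cubicDescent_eq_zero hW hcL two_ne_zero hχB hχ2B hwin P
  rw [← MordellDescent.phiDescent_eq_cubicDescent, hδ, hχL.map_mul haL (pow_ne_zero 3 hw),
    hχL.map_pow_three hw, add_zero, hχLK] at key
  exact key

include hodd hinert hsha in
/-- **The `√−3`-Selmer box for `A_t`.** If `[C_a] ∈ Ш(A/K3)` then `[a] = [∏_{q ∣ 2t} q^{e q}]` in `K3ˣ/K3ˣ³` for some
exponents `e q < 3` — the class of a natural number supported on the primes of `2t` (Jeong's Lemma 3.3 / Prop. 3.5 for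
`t = pq`, read for Selmer classes over `K3`). [cite: Jeong2019RankExactlyTwoII, Lemma 3.3 and Prop. 3.5] [cite: CohenPazuki2009, Thm. 2.1] -/
theorem exists_cubeClass_eq_of_sha :
    ∃ e : ℕ → ℕ, (∀ q, e q < 3) ∧
      MordellDescent.cubeClass a =
        MordellDescent.cubeClass (((∏ q ∈ (2 * t).primeFactors, q ^ e q : ℕ) : ℚ) : K3) := by
  have h2t0 : 2 * t ≠ 0 := Nat.mul_ne_zero two_ne_zero htz.ne
  have hN := inert_two_mul hinert
  obtain ⟨s, i, j, e, w, hs, hi, hj, he, hw, hnf⟩ :=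
    exists_normal_form_inert h2t0 hN ha (fun v hv => three_dvd_log_valuation_of_sha ha hsha v hv)
  have hj0 : j = 0 := j_eq_zero_of_dvd_inert h2t0 hN hs i j e hw hj
    (by rw [← hnf]; exact three_dvd_log_vL_of_sha_t hinert ha hsha)
  have hi0 : i = 0 := by
    have h := chi2_eq_zero_of_sha_t hodd ha hsha
    rw [hnf, hj0, pow_zero, mul_one, chi2_normalForm_inert hs i e hw] at h
    exact Nat.eq_zero_of_dvd_of_lt ((ZMod.natCast_eq_zero_iff i 3).mp h) hi
  refine ⟨e, he, ?_⟩
  rw [hnf, hj0, hi0]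
  exact cubeClass_normalForm_inert_of_i_j_eq_zero hs e hw

end Local

/-! ## §3 The descent classes of `A'(K3)` lie in the box; `rank A_t(ℚ) ≤ ω(t)` -/

section Rank

variable (hodd : ¬ 2 ∣ t) (hinert : ∀ q ∈ t.primeFactors, q % 3 = 2)

/-- Transport of the range of descent classes along an equality of curves. [folklore] -/
private theorem range_cubicDescentClass_congr {F : Type} [Field F] {W₁ W₂ : WeierstrassCurve F} (h : W₁ = W₂)
    (B : F) : Set.range (MordellDescent.cubicDescentClass W₁ B) = Set.range (MordellDescent.cubicDescentClass W₂ B) := by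
  subst h; rfl

omit htz in
/-- The descent classes of `A'(K3)` as classes of `phiDescent (3t)` and as the count theorem's
`cubicDescentClass (9·3t)`: the same set. [folklore] -/
private theorem range_eq_range :
    Set.range (fun P : (mordellCurve (81 * ((3 * t : ℕ) : K3) ^ 2)).toAffine.Point =>
        MordellDescent.cubeClass (MordellDescent.phiDescent ((3 * t : ℕ) : K3) P)) =
      Set.range (MordellDescent.cubicDescentClass (mordellCurve ((9 * ((3 * t : ℕ) : K3)) ^ 2))
        (9 * ((3 * t : ℕ) : K3))) := by
  have hcurve : mordellCurve (81 * ((3 * t : ℕ) : K3) ^ 2) = mordellCurve ((9 * ((3 * t : ℕ) : K3)) ^ 2) := by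
    congr 1; ring
  rw [← range_cubicDescentClass_congr hcurve]
  congr 1
  funext P
  exact MordellDescent.cubeClass_phiDescent _ P

omit htz in
/-- The box product indexed by `(2t).primeFactors.attach` with a `Fin 3`-valued exponent vector equals the `Finset`
product with the extended exponent function on `ℕ`. [folklore] -/
private theorem prod_attach_eq (f : (2 * t).primeFactors → Fin 3) :
    (∏ q ∈ (2 * t).primeFactors.attach, ((q : ℕ) : K3) ^ (f q : ℕ)) =
      ∏ q ∈ (2 * t).primeFactors, (q : K3) ^ (fun q => if hq : q ∈ (2 * t).primeFactors then (f ⟨q, hq⟩ : ℕ) else 0) q := by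
  rw [← Finset.prod_coe_sort (2 * t).primeFactors]
  refine Finset.prod_congr rfl fun x _ => ?_
  simp only [dif_pos x.2]

omit htz in
/-- The natural number `∏ q^{e q}` cast to `K3` is the product of the casts. [folklore] -/
private theorem cast_prodPow (s : Finset ℕ) (e : ℕ → ℕ) :
    (((∏ q ∈ s, q ^ e q : ℕ) : ℚ) : K3) = ∏ q ∈ s, (q : K3) ^ e q := by
  push_cast; rfl

include hodd hinert in
/-- **Every descent class of `A'(K3)` lies in the box `{[∏_{q ∣ 2t} q^{e q}] : e q < 3}`** (its torsor class is trivial,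
`torsorClass_phiDescent`). [cite: Jeong2019RankExactlyTwoII, Lemma 3.3] -/
theorem range_subset_box :
    Set.range (MordellDescent.cubicDescentClass (mordellCurve ((9 * ((3 * t : ℕ) : K3)) ^ 2)) (9 * ((3 * t : ℕ) : K3))) ⊆
      Set.range (fun e : (2 * t).primeFactors → Fin 3 =>
        MordellDescent.cubeClass (∏ q ∈ (2 * t).primeFactors.attach, ((q : ℕ) : K3) ^ (e q : ℕ))) := by
  rw [← range_eq_range]
  rintro _ ⟨P, rfl⟩
  have ha := MordellDescent.phiDescent_ne_zero hc P
  have hsha : MordellDescent.torsorClass hc hD ha ∈ (mordellCurve ((((3 * t : ℕ) : K3) * theta) ^ 2)).sha := by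
    rw [MordellDescent.torsorClass_phiDescent hc hD P]; exact AddSubgroup.zero_mem _
  obtain ⟨e, he, h⟩ := exists_cubeClass_eq_of_sha hodd hinert ha hsha
  refine ⟨fun q => ⟨e q, he q⟩, ?_⟩
  have hpa : (∏ q ∈ (2 * t).primeFactors.attach, ((q : ℕ) : K3) ^ e q) = ∏ q ∈ (2 * t).primeFactors, (q : K3) ^ e q :=
    Finset.prod_attach _ (fun q : ℕ => (q : K3) ^ e q)
  change MordellDescent.cubeClass (∏ q ∈ (2 * t).primeFactors.attach, ((q : ℕ) : K3) ^ (e q : ℕ)) =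
    MordellDescent.cubeClass (MordellDescent.phiDescent ((3 * t : ℕ) : K3) P)
  rw [hpa, h, cast_prodPow]

include hodd hinert in
/-- **`#δ(A'(K3)) ≤ 3^{ω(2t)}`.** [cite: Jeong2019RankExactlyTwoII, Lemma 3.3] -/
theorem natCard_range_le :
    Nat.card (Set.range (MordellDescent.cubicDescentClass (mordellCurve ((9 * ((3 * t : ℕ) : K3)) ^ 2))
        (9 * ((3 * t : ℕ) : K3)))) ≤ 3 ^ (2 * t).primeFactors.card := by
  rw [← natCard_range_prodPow_inert (inert_two_mul hinert)]
  exact Nat.card_mono (Set.toFinite _) (range_subset_box hodd hinert)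

include hodd hinert in
/-- **`rank (Y² = X³ + (27t)²)(ℚ) + 1 ≤ ω(2t)`** from the count `#δ(A'(K3)) = 3^{rank + 1} ≤ 3^{ω(2t)}`.
[cite: Jeong2019RankExactlyTwoII, Lemma 3.3 and Prop. 3.5] [cite: SilvermanAEC2009, X.4 Remark X.4.7] -/
theorem mordellWeilRank_succ_le' : (mordellCurve (((27 * t : ℕ) : ℚ) ^ 2)).mordellWeilRank + 1 ≤ (2 * t).primeFactors.card := by
  have hc' : (((3 * t : ℕ) : ℚ) : K3) = ((3 * t : ℕ) : K3) := by push_cast; ring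
  have hσc : conjBar (algebraMap K3 _ ((3 * t : ℕ) : K3)) = algebraMap K3 _ ((3 * t : ℕ) : K3) := by
    rw [← hc', conjBar_ratCast]
  have hb : ((27 * t : ℕ) : ℚ) ≠ 0 := by exact_mod_cast (Nat.mul_ne_zero (by norm_num) htz.ne)
  have hbc : algebraMap ℚ K3 ((27 * t : ℕ) : ℚ) = 9 * ((3 * t : ℕ) : K3) := by
    rw [map_natCast]; push_cast; ring
  have hcount := SqrtThree.natCard_range_cubicDescentClass_eq (K := K3) finrank_eq theta_sq conjBar
    conjBar_theta hσc hb hbc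
  have hle := natCard_range_le hodd hinert
  rw [hcount] at hle
  exact (Nat.pow_le_pow_iff_right (by norm_num : 2 ≤ 3)).mp hle

omit htz in
/-- `A_t : y² = x³ + t²` is `ℚ`-isomorphic (`u = 1/3`) to `Y² = X³ + (27t)²`: same rank. [cite: SilvermanAEC2009, III.1 (admissible change of variables)] -/
theorem mordellWeilRank_eq_27 : (mordellCurve (((t : ℕ) : ℚ) ^ 2)).mordellWeilRank =
    (mordellCurve (((27 * t : ℕ) : ℚ) ^ 2)).mordellWeilRank := by
  have hMW : ((⟨Units.mk0 (1 / 3 : ℚ) (by norm_num), 0, 0, 0⟩ : VariableChange ℚ) •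
      mordellCurve (((t : ℕ) : ℚ) ^ 2)).mordellWeilRank = (mordellCurve (((t : ℕ) : ℚ) ^ 2)).mordellWeilRank :=
    @WeierstrassCurve.VariableChange.finrank_point_variableChange ℚ _ (mordellCurve (((t : ℕ) : ℚ) ^ 2))
      ⟨Units.mk0 (1 / 3 : ℚ) (by norm_num), 0, 0, 0⟩ (Classical.decEq ℚ)
  rw [MordellPQ.variableChange_curve'] at hMW
  rw [← hMW, show (27 : ℚ) * ((t : ℕ) : ℚ) = ((27 * t : ℕ) : ℚ) by push_cast; ring]

include hodd hinert in
/-- **`rank A_t(ℚ) ≤ ω(t)` for every odd `t` all of whose prime factors are `≡ 2 (mod 3)`**, `A_t : y² = x³ + t²`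
(unconditional; `t = pq` is Jeong's `rank ≤ 2`, `t` prime gives `rank ≤ 1`, `t = 1` gives rank `0` for `y² = x³ + 1`).
[cite: Jeong2019RankExactlyTwoII, Prop. 3.5] -/
theorem mordellWeilRank_le_card_primeFactors :
    (mordellCurve (((t : ℕ) : ℚ) ^ 2)).mordellWeilRank ≤ t.primeFactors.card := by
  have h := mordellWeilRank_succ_le' hodd hinert
  rw [card_primeFactors_two_mul hodd, ← mordellWeilRank_eq_27] at h
  omega

include hodd hinert in
/-- The same bound for the `−3`-twist `E : y² = x³ − 27t²` (`3`-isogenous to `A_t`). [cite: Jeong2019RankExactlyTwoII, Prop. 3.5] -/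
theorem mordellWeilRank_twist_le_card_primeFactors :
    (mordellCurve (-27 * ((t : ℕ) : ℚ) ^ 2)).mordellWeilRank ≤ t.primeFactors.card := by
  rw [← SqrtThree.quadraticTwist_mordellCurve_sq, SqrtThree.mordellWeilRank_quadraticTwist_neg_three
    (by exact_mod_cast htz.ne)]
  exact mordellWeilRank_le_card_primeFactors hodd hinert

end Rank

/-! ## §4 Sharpness criterion: descent classes `[q]` for all primes `q ∣ 2t` ⇒ `Ш[3] = 0` and `rank = ω(t)` -/

section Sharp

variable (hodd : ¬ 2 ∣ t) (hinert : ∀ q ∈ t.primeFactors, q % 3 = 2)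
variable
  (hgen : ∀ q ∈ (2 * t).primeFactors, MordellDescent.cubeClass ((q : ℕ) : K3) ∈
    Set.range (fun P : (mordellCurve (81 * ((3 * t : ℕ) : K3) ^ 2)).toAffine.Point =>
      MordellDescent.cubeClass (MordellDescent.phiDescent ((3 * t : ℕ) : K3) P)))

/-- `cubeClass` is multiplicative on powers. [folklore] -/
private theorem cubeClass_pow' {F : Type} [Field F] {a : F} (ha : a ≠ 0) (n : ℕ) :
    MordellDescent.cubeClass (a ^ n) = MordellDescent.cubeClass a ^ n := by
  induction n with
  | zero => rw [pow_zero, pow_zero, MordellDescent.cubeClass_one]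
  | succ n ih => rw [pow_succ, pow_succ, MordellDescent.cubeClass_mul (pow_ne_zero _ ha) ha, ih]

omit htz in
/-- `cubeClass` of a product of prime powers is the product of the powers of the classes. [folklore] -/
private theorem cubeClass_prodPow (s : Finset ℕ) (e : ℕ → ℕ) (hs : ∀ q ∈ s, q ≠ 0) :
    MordellDescent.cubeClass (∏ q ∈ s, (q : K3) ^ e q) = ∏ q ∈ s, MordellDescent.cubeClass (q : K3) ^ e q := by
  induction s using Finset.induction_on with
  | empty => rw [Finset.prod_empty, Finset.prod_empty, MordellDescent.cubeClass_one]
  | insert a s has ih =>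
    have hs' : ∀ q ∈ s, q ≠ 0 := fun q hq => hs q (Finset.mem_insert_of_mem hq)
    have ha0 : (a : K3) ≠ 0 := by exact_mod_cast hs a (Finset.mem_insert_self a s)
    have hne : (∏ q ∈ s, (q : K3) ^ e q) ≠ 0 :=
      Finset.prod_ne_zero_iff.mpr fun q hq => pow_ne_zero _ (by exact_mod_cast hs' q hq)
    rw [Finset.prod_insert has, Finset.prod_insert has, MordellDescent.cubeClass_mul (pow_ne_zero _ ha0) hne,
      cubeClass_pow' ha0, ih hs']

omit htz in
include hgen in
/-- With every `[q]`, `q ∣ 2t`, among the descent classes, every box class `[∏ q^{e q}]` lies in the subgroup they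
generate. [cite: Jeong2019RankExactlyTwoII, §3] -/
theorem box_mem_closure (e : ℕ → ℕ) :
    MordellDescent.cubeClass (((∏ q ∈ (2 * t).primeFactors, q ^ e q : ℕ) : ℚ) : K3) ∈
      Subgroup.closure (Set.range (fun P : (mordellCurve (81 * ((3 * t : ℕ) : K3) ^ 2)).toAffine.Point =>
        MordellDescent.cubeClass (MordellDescent.phiDescent ((3 * t : ℕ) : K3) P))) := by
  rw [cast_prodPow, cubeClass_prodPow _ _ (fun q hq => (Nat.prime_of_mem_primeFactors hq).ne_zero)]
  exact Subgroup.prod_mem _ fun q hq => Subgroup.pow_mem _ (Subgroup.subset_closure (hgen q hq)) _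

include hodd hinert hgen in
/-- **Sharpness ⇒ `Ш(A/K3) ∩ ker [√−3]_* = 0`**: every torsor class in `Ш` has its `[a]` in the box, hence in the
subgroup generated by descent values, hence is trivial (`eq_zero_of_mem_sha_of_galH1Map_eq_zero`).
[cite: CohenPazuki2009, Thm. 2.1] [cite: Jeong2019RankExactlyTwoII, Prop. 3.5] -/
theorem eq_zero_of_mem_sha_of_f (c₀ : (mordellCurve ((((3 * t : ℕ) : K3) * theta) ^ 2)).galH1)
    (hc₀ : c₀ ∈ (mordellCurve ((((3 * t : ℕ) : K3) * theta) ^ 2)).sha)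
    (h0 : galH1Map (SqrtThree.sqrtThree (hBA (t := t)) theta_sq).toAddMonoidHom
      (SqrtThree.sqrtThree (hBA (t := t)) theta_sq).equivariant c₀ = 0) : c₀ = 0 := by
  refine MordellDescent.eq_zero_of_mem_sha_of_galH1Map_eq_zero hc hD (SqrtThree.sqrtThree hBA theta_sq).toAddMonoidHom
    (SqrtThree.sqrtThree hBA theta_sq).equivariant f_surjective f_ker (fun a ha hsha => ?_) hc₀ h0
  obtain ⟨e, -, h⟩ := exists_cubeClass_eq_of_sha hodd hinert ha hsha
  rw [h]
  exact box_mem_closure hgen e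

include hodd hinert hgen in
/-- **Sharpness ⇒ `Ш(A/ℚ(ζ₃))[3] = 0`** (`[√−3]² = −3`). [cite: CohenPazuki2009, Thm. 2.1] -/
theorem forall_mem_sha_three_nsmul_eq_zero :
    ∀ c₀ ∈ (mordellCurve ((((3 * t : ℕ) : K3) * theta) ^ 2)).sha, 3 • c₀ = 0 → c₀ = 0 := by
  haveI : (mordellCurve ((((3 * t : ℕ) : K3) * theta) ^ 2)).IsElliptic :=
    isElliptic_mordellCurve (pow_ne_zero 2 hBA)
  exact forall_mem_sha_nsmul_three_eq_zero_of_ker (SqrtThree.sqrtThree hBA theta_sq) f_comp_self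
    (eq_zero_of_mem_sha_of_f hodd hinert hgen)

omit htz in
/-- The base change of `E : y² = x³ − 27t²` to `K3` is `A : Y² = X³ + (3tθ)²`. [cite: Jeong2019RankExactlyTwoII, §3] -/
theorem baseChange_twist :
    (mordellCurve (-27 * ((t : ℕ) : ℚ) ^ 2)).baseChange K3 = mordellCurve ((((3 * t : ℕ) : K3) * theta) ^ 2) := by
  rw [mordellCurve_baseChange, mul_pow, theta_sq]
  congr 1
  simp only [map_mul, map_neg, map_pow, map_natCast, map_ofNat]
  push_cast
  ring

include hodd hinert hgen in
/-- **Sharpness ⇒ `Ш(E/ℚ)[3] = 0`** for `E : y² = x³ − 27t²` (restriction to `K3` is injective on `Ш[3]`,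
`3 ∤ [K3 : ℚ] = 2`). [cite: CohenPazuki2009, Thm. 2.1] [cite: Jeong2019RankExactlyTwoII, Prop. 3.5] -/
theorem forall_mem_sha_three_nsmul_eq_zero_rat :
    ∀ c₀ ∈ (mordellCurve (-27 * ((t : ℕ) : ℚ) ^ 2)).sha, 3 • c₀ = 0 → c₀ = 0 := by
  haveI : (mordellCurve (-27 * ((t : ℕ) : ℚ) ^ 2)).IsElliptic :=
    isElliptic_mordellCurve (mul_ne_zero (by norm_num) (pow_ne_zero 2 (by exact_mod_cast htz.ne)))
  haveI : IsGalois ℚ K3 := IsCyclotomicExtension.isGalois {3} ℚ K3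
  intro c₀ hc₀ h3
  have key : ∀ d ∈ ((mordellCurve (-27 * ((t : ℕ) : ℚ) ^ 2)).baseChange K3).sha, 3 • d = 0 → d = 0 := by
    rw [baseChange_twist]
    exact forall_mem_sha_three_nsmul_eq_zero hodd hinert hgen
  set c' : (mordellCurve (-27 * ((t : ℕ) : ℚ) ^ 2)).sha := ⟨c₀, hc₀⟩ with hc'
  have h3' : 3 • c' = 0 := Subtype.ext h3
  have hres : shaRestriction (mordellCurve (-27 * ((t : ℕ) : ℚ) ^ 2)) K3 c' = 0 := by
    apply Subtype.ext
    apply key _ (shaRestriction (mordellCurve (-27 * ((t : ℕ) : ℚ) ^ 2)) K3 c').2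
    rw [← AddSubgroupClass.coe_nsmul, ← map_nsmul, h3', map_zero]
    rfl
  have hcop : Nat.Coprime 3 (Module.finrank ℚ K3) := by rw [finrank_eq]; decide
  exact congrArg Subtype.val
    ((shaRestriction_eq_zero_iff_of_coprime (mordellCurve (-27 * ((t : ℕ) : ℚ) ^ 2)) K3 hcop c' h3').mp hres)

include hodd hinert hgen in
/-- **Sharpness ⇒ `corank_{ℤ₃} Ш(E/ℚ)[3^∞] = 0` and `Ш(E/ℚ)[3^∞] = 0`** for `E : y² = x³ − 27t²`.
[cite: Greenberg1999LNM, §1] -/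
theorem shaCorank_three_eq_zero :
    (mordellCurve (-27 * ((t : ℕ) : ℚ) ^ 2)).shaCorank 3 = 0 ∧
      AddCommGroup.primaryComponent (mordellCurve (-27 * ((t : ℕ) : ℚ) ^ 2)).sha 3 = ⊥ :=
  haveI : Fact (Nat.Prime 3) := ⟨Nat.prime_three⟩
  ⟨shaCorank_eq_zero_of_forall _ 3 (forall_mem_sha_three_nsmul_eq_zero_rat hodd hinert hgen),
    primaryComponent_sha_eq_bot_of_forall _ (forall_mem_sha_three_nsmul_eq_zero_rat hodd hinert hgen)⟩

/-- The descent classes form a subgroup of `K3ˣ/K3ˣ³`. [cite: SilvermanAEC2009, X.4 Remark X.4.7] -/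
theorem exists_subgroup_range :
    ∃ H : Subgroup (MordellDescent.CubeUnits K3),
      (H : Set (MordellDescent.CubeUnits K3)) =
        Set.range (MordellDescent.cubicDescentClass (mordellCurve ((9 * ((3 * t : ℕ) : K3)) ^ 2)) (9 * ((3 * t : ℕ) : K3))) := by
  have h9 : (9 : K3) * ((3 * t : ℕ) : K3) ≠ 0 := mul_ne_zero (by norm_num) hc
  refine ⟨{ carrier := Set.range (MordellDescent.cubicDescentClass (mordellCurve ((9 * ((3 * t : ℕ) : K3)) ^ 2))
              (9 * ((3 * t : ℕ) : K3)))
            mul_mem' := ?_, one_mem' := ⟨0, MordellDescent.cubicDescentClass_zero _⟩, inv_mem' := ?_ }, rfl⟩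
  · rintro _ _ ⟨P, rfl⟩ ⟨Q, rfl⟩
    exact ⟨_, MordellDescent.cubicDescentClass_add rfl two_ne_zero h9 P Q⟩
  · rintro _ ⟨P, rfl⟩
    exact ⟨_, eq_inv_of_mul_eq_one_left (MordellDescent.cubicDescentClass_neg_mul rfl two_ne_zero h9 P)⟩

include hgen in
/-- With the generators `[q]`, `q ∣ 2t`, present, the whole box consists of descent classes. [cite: Jeong2019RankExactlyTwoII, §3] -/
theorem box_subset_range :
    Set.range (fun e : (2 * t).primeFactors → Fin 3 =>
        MordellDescent.cubeClass (∏ q ∈ (2 * t).primeFactors.attach, ((q : ℕ) : K3) ^ (e q : ℕ))) ⊆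
      Set.range (MordellDescent.cubicDescentClass (mordellCurve ((9 * ((3 * t : ℕ) : K3)) ^ 2)) (9 * ((3 * t : ℕ) : K3))) := by
  obtain ⟨H, hH⟩ := exists_subgroup_range (t := t)
  rintro _ ⟨e, rfl⟩
  have hmem := box_mem_closure hgen (fun q => if hq : q ∈ (2 * t).primeFactors then (e ⟨q, hq⟩ : ℕ) else 0)
  rw [cast_prodPow, ← prod_attach_eq, range_eq_range, ← hH] at hmem
  change MordellDescent.cubeClass (∏ q ∈ (2 * t).primeFactors.attach, ((q : ℕ) : K3) ^ (e q : ℕ)) ∈ _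
  rw [← hH]
  exact (Subgroup.closure_le H).mpr (fun x hx => hx) hmem

include hodd hinert hgen in
/-- **Sharpness ⇒ `rank A_t(ℚ) = ω(t)` and `rank (y² = x³ − 27t²)(ℚ) = ω(t)` exactly.** [cite: Jeong2019RankExactlyTwoII, Prop. 3.5] -/
theorem mordellWeilRank_eq_card_primeFactors :
    (mordellCurve (((t : ℕ) : ℚ) ^ 2)).mordellWeilRank = t.primeFactors.card ∧
      (mordellCurve (-27 * ((t : ℕ) : ℚ) ^ 2)).mordellWeilRank = t.primeFactors.card := by
  -- the descent image is exactly the box: `3^{ω(2t)}` elements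
  have hcard : Nat.card (Set.range (MordellDescent.cubicDescentClass
      (mordellCurve ((9 * ((3 * t : ℕ) : K3)) ^ 2)) (9 * ((3 * t : ℕ) : K3)))) = 3 ^ (2 * t).primeFactors.card := by
    rw [Set.Subset.antisymm (range_subset_box hodd hinert) (box_subset_range hgen),
      natCard_range_prodPow_inert (inert_two_mul hinert)]
  have hc' : (((3 * t : ℕ) : ℚ) : K3) = ((3 * t : ℕ) : K3) := by push_cast; ring
  have hσc : conjBar (algebraMap K3 _ ((3 * t : ℕ) : K3)) = algebraMap K3 _ ((3 * t : ℕ) : K3) := by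
    rw [← hc', conjBar_ratCast]
  have ht0' : ((t : ℕ) : ℚ) ≠ 0 := by exact_mod_cast htz.ne
  have hb : ((27 * t : ℕ) : ℚ) ≠ 0 := by exact_mod_cast (Nat.mul_ne_zero (by norm_num) htz.ne)
  have hbc : algebraMap ℚ K3 ((27 * t : ℕ) : ℚ) = 9 * ((3 * t : ℕ) : K3) := by
    rw [map_natCast]; push_cast; ring
  have hcount := SqrtThree.natCard_range_cubicDescentClass_eq (K := K3) finrank_eq theta_sq conjBar
    conjBar_theta hσc hb hbc
  rw [hcard] at hcount
  have hr' : (mordellCurve (((27 * t : ℕ) : ℚ) ^ 2)).mordellWeilRank + 1 = (2 * t).primeFactors.card :=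
    (Nat.pow_right_injective (by norm_num : 2 ≤ 3) hcount).symm
  rw [card_primeFactors_two_mul hodd, ← mordellWeilRank_eq_27] at hr'
  have hr : (mordellCurve (((t : ℕ) : ℚ) ^ 2)).mordellWeilRank = t.primeFactors.card := by omega
  refine ⟨hr, ?_⟩
  rw [← SqrtThree.quadraticTwist_mordellCurve_sq, SqrtThree.mordellWeilRank_quadraticTwist_neg_three ht0', hr]

include hodd hinert hgen in
/-- **Sharpness ⇒ the door at `3` at rank `ω(t)`**: `E : y² = x³ − 27t²` has `rank E(ℚ) = ω(t)`, `t_3(E) = 0`,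
`Ш(E/ℚ)[3^∞] = 0` and `corank_{ℤ₃} Sel_{3^∞}(E/ℚ) = ω(t)`. [cite: Jeong2019RankExactlyTwoII, Prop. 3.5] [cite: Greenberg1999LNM, §1] -/
theorem door_at_three_of_generators :
    (mordellCurve (-27 * ((t : ℕ) : ℚ) ^ 2)).mordellWeilRank = t.primeFactors.card ∧
      (mordellCurve (-27 * ((t : ℕ) : ℚ) ^ 2)).shaCorank 3 = 0 ∧
      AddCommGroup.primaryComponent (mordellCurve (-27 * ((t : ℕ) : ℚ) ^ 2)).sha 3 = ⊥ ∧
      (mordellCurve (-27 * ((t : ℕ) : ℚ) ^ 2)).selmerCorank 3 = t.primeFactors.card := by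
  haveI : (mordellCurve (-27 * ((t : ℕ) : ℚ) ^ 2)).IsElliptic :=
    isElliptic_mordellCurve (mul_ne_zero (by norm_num) (pow_ne_zero 2 (by exact_mod_cast htz.ne)))
  haveI : Fact (Nat.Prime 3) := ⟨Nat.prime_three⟩
  obtain ⟨-, hr⟩ := mordellWeilRank_eq_card_primeFactors hodd hinert hgen
  obtain ⟨hsha, hprim⟩ := shaCorank_three_eq_zero hodd hinert hgen
  refine ⟨hr, hsha, hprim, ?_⟩
  rw [(mordellCurve (-27 * ((t : ℕ) : ℚ) ^ 2)).selmerCorank_eq_mordellWeilRank_add_holds 3, hr, hsha, add_zero]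

end Sharp

/-! ## §5 Sharpness from GENERATING points: the closure form of the criterion -/

section Closure

variable (hodd : ¬ 2 ∣ t) (hinert : ∀ q ∈ t.primeFactors, q % 3 = 2)

/-- **The descent classes are closed under products**: membership in the subgroup GENERATED by the descent values of
`A'(K3)` is membership in the set of descent values itself (`δ` is a homomorphism modulo cubes, Silverman X.4.7; tree
`exists_subgroup_range`). So a family of points whose classes merely GENERATE the box suffices for sharpness.
[cite: SilvermanAEC2009, X.4 Remark X.4.7] -/
theorem mem_range_of_mem_closure {x : MordellDescent.CubeUnits K3}
    (hx : x ∈ Subgroup.closure (Set.range (fun P : (mordellCurve (81 * ((3 * t : ℕ) : K3) ^ 2)).toAffine.Point =>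
      MordellDescent.cubeClass (MordellDescent.phiDescent ((3 * t : ℕ) : K3) P)))) :
    x ∈ Set.range (fun P : (mordellCurve (81 * ((3 * t : ℕ) : K3) ^ 2)).toAffine.Point =>
      MordellDescent.cubeClass (MordellDescent.phiDescent ((3 * t : ℕ) : K3) P)) := by
  obtain ⟨H, hH⟩ := exists_subgroup_range (t := t)
  rw [range_eq_range, ← hH] at hx ⊢
  exact (Subgroup.closure_le H).mpr (fun y hy => hy) hx

include hodd hinert in
/-- **The door at `3` at rank `ω(t)` from generating points**: if every `[q]`, `q ∣ 2t` prime, lies in the subgroup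
GENERATED by the descent values of points of `A'(K3)` (e.g. products of descent values of rational points), then
`E : y² = x³ − 27t²` has `rank E(ℚ) = ω(t)`, `t_3(E) = 0`, `Ш(E/ℚ)[3^∞] = 0`, `corank_{ℤ₃} Sel_{3^∞}(E/ℚ) = ω(t)`, and
`rank(y² = x³ + t²)(ℚ) = ω(t)`. [cite: Jeong2019RankExactlyTwoII, Prop. 3.5] [cite: Greenberg1999LNM, §1] -/
theorem door_at_three_of_closure
    (hgen : ∀ q ∈ (2 * t).primeFactors, MordellDescent.cubeClass ((q : ℕ) : K3) ∈
      Subgroup.closure (Set.range (fun P : (mordellCurve (81 * ((3 * t : ℕ) : K3) ^ 2)).toAffine.Point =>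
        MordellDescent.cubeClass (MordellDescent.phiDescent ((3 * t : ℕ) : K3) P)))) :
    (mordellCurve (-27 * ((t : ℕ) : ℚ) ^ 2)).mordellWeilRank = t.primeFactors.card ∧
      (mordellCurve (-27 * ((t : ℕ) : ℚ) ^ 2)).shaCorank 3 = 0 ∧
      AddCommGroup.primaryComponent (mordellCurve (-27 * ((t : ℕ) : ℚ) ^ 2)).sha 3 = ⊥ ∧
      (mordellCurve (-27 * ((t : ℕ) : ℚ) ^ 2)).selmerCorank 3 = t.primeFactors.card ∧
      (mordellCurve (((t : ℕ) : ℚ) ^ 2)).mordellWeilRank = t.primeFactors.card :=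
  have hgen' : ∀ q ∈ (2 * t).primeFactors, MordellDescent.cubeClass ((q : ℕ) : K3) ∈
      Set.range (fun P : (mordellCurve (81 * ((3 * t : ℕ) : K3) ^ 2)).toAffine.Point =>
        MordellDescent.cubeClass (MordellDescent.phiDescent ((3 * t : ℕ) : K3) P)) :=
    fun q hq => mem_range_of_mem_closure (hgen q hq)
  let h := door_at_three_of_generators hodd hinert hgen'
  ⟨h.1, h.2.1, h.2.2.1, h.2.2.2, (mordellWeilRank_eq_card_primeFactors hodd hinert hgen').1⟩

include hodd hinert in
/-- `Ш(E/ℚ)[3] = 0` elementwise, closure form. [cite: CohenPazuki2009, Thm. 2.1] -/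
theorem forall_mem_sha_three_nsmul_eq_zero_rat_of_closure
    (hgen : ∀ q ∈ (2 * t).primeFactors, MordellDescent.cubeClass ((q : ℕ) : K3) ∈
      Subgroup.closure (Set.range (fun P : (mordellCurve (81 * ((3 * t : ℕ) : K3) ^ 2)).toAffine.Point =>
        MordellDescent.cubeClass (MordellDescent.phiDescent ((3 * t : ℕ) : K3) P)))) :
    ∀ c₀ ∈ (mordellCurve (-27 * ((t : ℕ) : ℚ) ^ 2)).sha, 3 • c₀ = 0 → c₀ = 0 :=
  forall_mem_sha_three_nsmul_eq_zero_rat hodd hinert fun q hq => mem_range_of_mem_closure (hgen q hq)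

end Closure

end MordellT

end Literature.NumberTheory.EllipticCurves
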